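import Summits.CriticalPhenomena.Ising3DConformalLimit.Theses.MonotoneBlocking
import Summits.CriticalPhenomena.Ising3DConformalLimit.Theorems.HyperoctahedralRPExistsScaleCovariantLimitBlockDefs
import HarnessLib

/-!
# `MonotoneBlockingTwo` (BM₂, item stmt-CriticalPhenomena-17054): an explicit NON-SUMMABLE kernel with every
# two-point feature the tree knows violates the inequality — the short-distance values are load-bearing

Negative / structural knowledge about the crux
`Summit.CriticalPhenomena.Ising3DConformalLimit.Theses.MonotoneBlocking.MonotoneBlockingTwo` (route
`MonotoneBlocking`), standing crux disprover, cycle 1 (D-0016). THEOREM-ONLY: the witness kernel is written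
inline as `W(z) = 1 / max 1 ‖z‖∞` with the integer sup-norm spelled `max |z 0| (max |z 1| |z 2|)` (ℕ-valued).

Companion of `…/Negative/SummableRigidity.lean` (there: BM₂ + `χ < ∞` ⟹ white noise, so `χ(β_c) = ∞` is
NECESSARY). Here: `χ = ∞` together with positivity, `G(0) = 1 ≥ G`, evenness and point-group invariance,
`‖·‖∞`-radial monotonicity (hence the Messager–Miracle-Solé sandwich) and BOTH power envelopes
`‖z‖⁻² ≤ G ≤ ‖z‖⁻¹` of `criticalTwoPoint_bounds` at `d = 3` is still NOT SUFFICIENT: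

* `witness_not_shape`: for `W(z) = 1/max(1,‖z‖∞)` the BM₂ shape
  `C_W(L,k)·C_W(L+1,0) ≤ C_W(L+1,k)·C_W(L,0)` (`C_W(L,k) = Σ_{x,y∈cube L} W(L•k+x−y)`, the route's `bc` verbatim)
  FAILS at `L = 1`, `k = (1,1,1)`: it would say `64 ≤ C_W(2,(1,1,1))`, but only the pair `(0,(1,1,1))` of the
  64 lands on the first shell, so `C_W(2,(1,1,1)) ≤ 64/2 + 1/2`.
* `witness_pos`, `witness_le_one`, `witness_zero`, `witness_neg`, `witness_antitone`, `witness_envelopes`,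
  `witness_not_summable`: the features `W` shares with `criticalTwoPoint 3`.

What `W` lacks is the nearest-neighbour model's short-distance PROFILE: its first shell is flat
(`W(1,1,1) = W(1,0,0) = 1`) where the model has `⟨σ₀σ_{(1,1,1)}⟩/⟨σ₀σ_{(1,0,0)}⟩ ≈ 0.50`, and BM₂ at
`(L,k) = (1,(1,1,1))` reads `⟨σ₀σ_{(1,1,1)}⟩·⟨S_2²⟩ ≤ ⟨S_2(0)S_2((2,2,2))⟩` (MC: `3.7 ≤ 5.8`). So a proof of the
crux must consume ultraviolet NUMBERS of `⟨σ₀σ_x⟩_{β_c(3)}`, not only qualitative two-point structure — the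
kernel-checked form of the census remark (`Cruxes/MonotoneBlockingTwo/STRATEGY-CENSUS.md`, BM2UV) and of
caveat (O6d) of `Literature.Barriers.CriticalPhenomena.LongRangeTrivialityOnZ3MonotoneBlockingAudit`.
-/

noncomputable section

namespace Summit.CriticalPhenomena.Ising3DConformalLimit.MonotoneBlockingTwoNegative

open Literature.Probability.LatticeModels Finset
open scoped BigOperators
open Summit.CriticalPhenomena.Ising3DConformalLimit.Cruxes.ExistsScaleCovariantLimit.MonotoneBlockingPort
  (cube mem_cube card_cube cube_zero)

/-! ### The witness `W(z) = 1/max(1, ‖z‖∞)`, written inline -/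

/-- `W > 0`. [folklore] -/
theorem witness_pos (z : Site 3) :
    0 < (1 : ℝ) / max 1 ((max (z 0).natAbs (max (z 1).natAbs (z 2).natAbs) : ℕ) : ℝ) := by positivity

/-- `W ≤ 1`. [folklore] -/
theorem witness_le_one (z : Site 3) :
    (1 : ℝ) / max 1 ((max (z 0).natAbs (max (z 1).natAbs (z 2).natAbs) : ℕ) : ℝ) ≤ 1 := by
  rw [div_le_one (by positivity)]; exact le_max_left _ _

/-- `W(0) = 1`. [folklore] -/
theorem witness_zero :
    (1 : ℝ) / max 1 ((max ((0 : Site 3) 0).natAbs (max ((0 : Site 3) 1).natAbs ((0 : Site 3) 2).natAbs)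
      : ℕ) : ℝ) = 1 := by
  simp

/-- `W` is even. [folklore] -/
theorem witness_neg (z : Site 3) :
    (1 : ℝ) / max 1 ((max ((-z) 0).natAbs (max ((-z) 1).natAbs ((-z) 2).natAbs) : ℕ) : ℝ) =
      1 / max 1 ((max (z 0).natAbs (max (z 1).natAbs (z 2).natAbs) : ℕ) : ℝ) := by
  simp

/-- `W` is `‖·‖∞`-radially non-increasing (so it has the Messager–Miracle-Solé sandwich
`w(‖z‖₁) ≤ W(z) ≤ w(‖z‖∞)` along its own axis profile `w(n) = 1/max(1,n)`). [folklore] -/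
theorem witness_antitone {z z' : Site 3}
    (h : max (z 0).natAbs (max (z 1).natAbs (z 2).natAbs) ≤ max (z' 0).natAbs (max (z' 1).natAbs (z' 2).natAbs)) :
    (1 : ℝ) / max 1 ((max (z' 0).natAbs (max (z' 1).natAbs (z' 2).natAbs) : ℕ) : ℝ) ≤
      1 / max 1 ((max (z 0).natAbs (max (z 1).natAbs (z 2).natAbs) : ℕ) : ℝ) := by
  have h' : ((max (z 0).natAbs (max (z 1).natAbs (z 2).natAbs) : ℕ) : ℝ) ≤
      ((max (z' 0).natAbs (max (z' 1).natAbs (z' 2).natAbs) : ℕ) : ℝ) := by exact_mod_cast h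
  have h1 : (1:ℝ) ≤ max 1 ((max (z 0).natAbs (max (z 1).natAbs (z 2).natAbs) : ℕ) : ℝ) := le_max_left _ _
  exact one_div_le_one_div_of_le (by positivity) (max_le_max le_rfl h')

/-- BOTH POWER ENVELOPES of `criticalTwoPoint_bounds` at `d = 3` (`c‖z‖⁻² ≤ G ≤ C‖z‖⁻¹`, here `c = C = 1`),
off the origin (`‖z‖∞ ≥ 1`). [folklore] -/
theorem witness_envelopes {z : Site 3} (hz : 1 ≤ max (z 0).natAbs (max (z 1).natAbs (z 2).natAbs)) :
    1 / ((max (z 0).natAbs (max (z 1).natAbs (z 2).natAbs) : ℕ) : ℝ) ^ 2 ≤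
        (1 : ℝ) / max 1 ((max (z 0).natAbs (max (z 1).natAbs (z 2).natAbs) : ℕ) : ℝ) ∧
      (1 : ℝ) / max 1 ((max (z 0).natAbs (max (z 1).natAbs (z 2).natAbs) : ℕ) : ℝ) ≤
        1 / ((max (z 0).natAbs (max (z 1).natAbs (z 2).natAbs) : ℕ) : ℝ) := by
  have h1 : (1:ℝ) ≤ ((max (z 0).natAbs (max (z 1).natAbs (z 2).natAbs) : ℕ) : ℝ) := by exact_mod_cast hz
  rw [max_eq_right h1]
  exact ⟨one_div_le_one_div_of_le (by positivity) (by nlinarith), le_rfl⟩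

/-- **`χ_W = ∞`**: `W` is NOT summable (its axis profile `W((n+1)e₀) = 1/(n+1)` is harmonic). [folklore] -/
theorem witness_not_summable :
    ¬ Summable (fun z : Site 3 => (1 : ℝ) / max 1 ((max (z 0).natAbs (max (z 1).natAbs (z 2).natAbs) : ℕ) : ℝ)) := by
  intro hs
  have hinj : Function.Injective (fun n : ℕ => (Pi.single 0 ((n:ℤ) + 1) : Site 3)) := by
    intro a b hab
    have := congr_fun hab 0
    simp only [Pi.single_eq_same] at this
    omega
  have haxis : ∀ n : ℕ, (1 : ℝ) / max 1 ((max ((Pi.single 0 ((n:ℤ) + 1) : Site 3) 0).natAbs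
      (max ((Pi.single 0 ((n:ℤ) + 1) : Site 3) 1).natAbs ((Pi.single 0 ((n:ℤ) + 1) : Site 3) 2).natAbs)
        : ℕ) : ℝ) = 1 / ((n:ℝ) + 1) := by
    intro n
    have h : max ((Pi.single 0 ((n:ℤ) + 1) : Site 3) 0).natAbs
        (max ((Pi.single 0 ((n:ℤ) + 1) : Site 3) 1).natAbs ((Pi.single 0 ((n:ℤ) + 1) : Site 3) 2).natAbs)
          = n + 1 := by
      simp only [Pi.single_eq_same, ne_eq, one_ne_zero, not_false_eq_true, Pi.single_eq_of_ne,
        Int.natAbs_zero, max_self, Nat.max_zero, Fin.reduceEq]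
      omega
    rw [h, max_eq_right (by push_cast; linarith)]
    push_cast
    ring
  have hsub : Summable (fun n : ℕ => 1 / ((n:ℝ) + 1)) := (hs.comp_injective hinj).congr haxis
  have h1 : Summable (fun n : ℕ => 1 / (n:ℝ)) :=
    (summable_nat_add_iff 1).1 (by simpa [Nat.cast_add, Nat.cast_one] using hsub)
  exact Real.not_summable_one_div_natCast h1

/-! ### The violation at `L = 1`, `k = (1,1,1)` -/

/-- `cube 1 = {0}`. [folklore] -/
theorem cube_one_eq : cube 1 = {0} := by
  have : (Finset.Ico (0:ℤ) ((1:ℕ):ℤ)) = {0} := by decide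
  rw [cube]; simp only [this]; exact Fintype.piFinset_singleton (fun _ : Fin 3 => (0:ℤ))

/-- **THE WITNESS VIOLATES BM₂.** For `W(z) = 1/max(1,‖z‖∞)` the route's inequality (with `W` for
`criticalTwoPoint 3`) fails at `L = 1`, `k = (1,1,1)`: `W(1,1,1)·C_W(2,0) = 64` while
`C_W(2,(1,1,1)) ≤ 64/2 + 1/2` (every pair but `(0,(1,1,1))` is at sup-distance `≥ 2`). [folklore] -/
theorem witness_not_shape :
    ¬ ∀ L : ℕ, 1 ≤ L → ∀ k : Site 3,
      (∑ x ∈ cube L, ∑ y ∈ cube L, (1 : ℝ) / max 1 ((max (((L:ℤ) • k + x - y) 0).natAbs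
          (max (((L:ℤ) • k + x - y) 1).natAbs (((L:ℤ) • k + x - y) 2).natAbs) : ℕ) : ℝ)) *
        (∑ x ∈ cube (L + 1), ∑ y ∈ cube (L + 1), (1 : ℝ) / max 1
          ((max ((((L + 1 : ℕ) : ℤ) • (0 : Site 3) + x - y) 0).natAbs
            (max ((((L + 1 : ℕ) : ℤ) • (0 : Site 3) + x - y) 1).natAbs
              ((((L + 1 : ℕ) : ℤ) • (0 : Site 3) + x - y) 2).natAbs) : ℕ) : ℝ)) ≤
      (∑ x ∈ cube (L + 1), ∑ y ∈ cube (L + 1), (1 : ℝ) / max 1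
          ((max ((((L + 1 : ℕ) : ℤ) • k + x - y) 0).natAbs
            (max ((((L + 1 : ℕ) : ℤ) • k + x - y) 1).natAbs ((((L + 1 : ℕ) : ℤ) • k + x - y) 2).natAbs)
              : ℕ) : ℝ)) *
        (∑ x ∈ cube L, ∑ y ∈ cube L, (1 : ℝ) / max 1 ((max (((L:ℤ) • (0 : Site 3) + x - y) 0).natAbs
          (max (((L:ℤ) • (0 : Site 3) + x - y) 1).natAbs (((L:ℤ) • (0 : Site 3) + x - y) 2).natAbs)
            : ℕ) : ℝ)) := by
  intro h
  -- abbreviate the witness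
  set W : Site 3 → ℝ := fun z => (1 : ℝ) / max 1 ((max (z 0).natAbs (max (z 1).natAbs (z 2).natAbs) : ℕ) : ℝ)
    with hWdef
  have hWle : ∀ z, W z ≤ 1 := fun z => witness_le_one z
  have hWone : ∀ z : Site 3, max (z 0).natAbs (max (z 1).natAbs (z 2).natAbs) ≤ 1 → W z = 1 := by
    intro z hz
    simp only [hWdef]
    rw [max_eq_left (by exact_mod_cast hz)]; simp
  have hWhalf : ∀ z : Site 3, 2 ≤ max (z 0).natAbs (max (z 1).natAbs (z 2).natAbs) → W z ≤ 1 / 2 := by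
    intro z hz
    simp only [hWdef]
    have h2 : (2:ℝ) ≤ ((max (z 0).natAbs (max (z 1).natAbs (z 2).natAbs) : ℕ) : ℝ) := by exact_mod_cast hz
    rw [max_eq_right (by linarith)]
    exact one_div_le_one_div_of_le (by norm_num) h2
  let diag : Site 3 := fun _ => 1
  have h1 := h 1 le_rfl diag
  -- rewrite the four block sums in terms of `W`
  change (∑ x ∈ cube 1, ∑ y ∈ cube 1, W ((1:ℕ) • diag + x - y)) *
      (∑ x ∈ cube (1 + 1), ∑ y ∈ cube (1 + 1), W (((1 + 1 : ℕ) : ℤ) • (0 : Site 3) + x - y)) ≤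
    (∑ x ∈ cube (1 + 1), ∑ y ∈ cube (1 + 1), W (((1 + 1 : ℕ) : ℤ) • diag + x - y)) *
      (∑ x ∈ cube 1, ∑ y ∈ cube 1, W ((1:ℕ) • (0 : Site 3) + x - y)) at h1
  have hdiag1 : W diag = 1 := hWone diag (by simp [diag])
  have hW0 : W 0 = 1 := hWone 0 (by simp)
  simp only [cube_one_eq, Finset.sum_singleton, add_zero, sub_zero, one_smul, smul_zero, hdiag1, hW0,
    one_mul, mul_one, Nat.reduceAdd] at h1
  have hdiag : diag ∈ cube 2 := by rw [mem_cube]; intro i; simp [diag]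
  have hzero : (0 : Site 3) ∈ cube 2 := by rw [mem_cube]; intro i; simp
  -- C_W(2,0) = 64
  have h64 : (∑ x ∈ cube 2, ∑ y ∈ cube 2, W ((0 : Site 3) + x - y)) = 64 := by
    have hterm : ∀ x ∈ cube 2, ∀ y ∈ cube 2, W ((0 : Site 3) + x - y) = 1 := by
      intro x hx y hy
      rw [mem_cube] at hx hy
      apply hWone
      have h0 := hx 0; have h1' := hx 1; have h2 := hx 2
      have g0 := hy 0; have g1 := hy 1; have g2 := hy 2
      simp only [zero_add, Pi.sub_apply]
      omega
    rw [Finset.sum_congr rfl fun x hx => Finset.sum_congr rfl fun y hy => hterm x hx y hy]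
    simp only [Finset.sum_const, card_cube, nsmul_eq_mul, mul_one]
    norm_num
  -- C_W(2,diag) ≤ 32 + 1/2
  have hcoord : ∀ (w : Site 3) (i : Fin 3), (w i).natAbs ≤ max (w 0).natAbs (max (w 1).natAbs (w 2).natAbs) := by
    intro w i
    have a0 : (w 0).natAbs ≤ max (w 0).natAbs (max (w 1).natAbs (w 2).natAbs) := by omega
    have a1 : (w 1).natAbs ≤ max (w 0).natAbs (max (w 1).natAbs (w 2).natAbs) := by omega
    have a2 : (w 2).natAbs ≤ max (w 0).natAbs (max (w 1).natAbs (w 2).natAbs) := by omega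
    fin_cases i
    · exact a0
    · exact a1
    · exact a2
  have hle : (∑ x ∈ cube 2, ∑ y ∈ cube 2, W (((2:ℕ):ℤ) • diag + x - y)) ≤ 64 * (1 / 2) + 1 / 2 := by
    have hterm : ∀ x ∈ cube 2, ∀ y ∈ cube 2, W (((2:ℕ):ℤ) • diag + x - y) ≤
        1 / 2 + (if x = 0 then (1:ℝ) / 2 else 0) * (if y = diag then 1 else 0) := by
      intro x hx y hy
      rw [mem_cube] at hx hy
      by_cases hx0 : x = 0
      · by_cases hyd : y = diag
        · rw [if_pos hx0, if_pos hyd]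
          exact le_trans (hWle _) (by norm_num)
        · rw [if_neg hyd, mul_zero, add_zero]
          apply hWhalf
          obtain ⟨i, hi⟩ := Function.ne_iff.1 hyd
          refine le_trans ?_ (hcoord _ i)
          have hyi := hy i; have hxi := hx i
          simp only [diag] at hi
          simp only [diag, Pi.sub_apply, Pi.add_apply, Pi.smul_apply, smul_eq_mul, mul_one, Nat.cast_ofNat]
          omega
      · rw [if_neg hx0, zero_mul, add_zero]
        apply hWhalf
        obtain ⟨i, hi⟩ := Function.ne_iff.1 hx0
        refine le_trans ?_ (hcoord _ i)
        have hyi := hy i; have hxi := hx i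
        simp only [Pi.zero_apply] at hi
        simp only [diag, Pi.sub_apply, Pi.add_apply, Pi.smul_apply, smul_eq_mul, mul_one, Nat.cast_ofNat]
        omega
    calc (∑ x ∈ cube 2, ∑ y ∈ cube 2, W (((2:ℕ):ℤ) • diag + x - y))
        ≤ ∑ x ∈ cube 2, ∑ y ∈ cube 2,
            (1 / 2 + (if x = 0 then (1:ℝ) / 2 else 0) * (if y = diag then 1 else 0)) :=
          Finset.sum_le_sum fun x hx => Finset.sum_le_sum fun y hy => hterm x hx y hy
      _ = 64 * (1 / 2) + 1 / 2 := by
          have hrow : ∀ x ∈ cube 2,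
              (∑ y ∈ cube 2, (1 / 2 + (if x = 0 then (1:ℝ) / 2 else 0) * (if y = diag then 1 else 0))) =
                8 * (1 / 2) + (if x = 0 then (1:ℝ) / 2 else 0) := by
            intro x _
            rw [Finset.sum_add_distrib, Finset.sum_const, card_cube, ← Finset.mul_sum,
              Finset.sum_ite_eq' (cube 2) diag, if_pos hdiag, nsmul_eq_mul]
            norm_num
          rw [Finset.sum_congr rfl hrow, Finset.sum_add_distrib, Finset.sum_const, card_cube, nsmul_eq_mul,
            Finset.sum_ite_eq' (cube 2) (0 : Site 3), if_pos hzero]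
          norm_num
  rw [h64] at h1
  have key : ∀ S : ℝ, 64 ≤ S → S ≤ 64 * (1 / 2) + 1 / 2 → False := fun S h₁ h₂ => by linarith
  exact key _ h1 hle

end Summit.CriticalPhenomena.Ising3DConformalLimit.MonotoneBlockingTwoNegative

end
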